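import Mathlib
import Literature.Computability.Complexity.RangeAvoidance
import Literature.Computability.Complexity.SignDegreeXor
import Literature.Computability.Complexity.LocalAvoidAlgorithms
import Summits.PneNP.PneNP.Theorems.PstarIsolation

/-!
# Pure `P⋆` maps: the TYPED reduction (doubling) and the structure `Range = Cut ⊕ Clique` of typed instances

FRONTIER range-avoidance ladder, roof F-N3 `PstarIsolation.PstarAvoidLinearFP` (pure `P⋆` maps
`y_j = x_{a_j} ⊕ x_{b_j} ⊕ x_{c_j}·x_{d_j}` at linear stretch; restricted-model algorithmics — nothing here bears on
`P` vs `NP`).  Cell `pnp-ideate`, ROUND-20 SEED §2, targets T20.1–T20.2 (the FP transfer T20.3 is the machine file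
`PstarTypedDoubleFP`).

* A pure `P⋆` instance is TYPED (`Typed`) if no variable occurs both in an XOR slot and in an AND slot.
* DOUBLING (`typedDouble`): put the XOR slots on a first copy of the variables and the AND slots on a second copy,
  `f̃(t,z)_j = t_{a_j} ⊕ t_{b_j} ⊕ z_{c_j}·z_{d_j}` on `n + n` inputs; then `f(x) = f̃(x,x)` (`eval_typedDouble_append`),
  so `Range f ⊆ Range f̃` (`range_subset_range_typedDouble`), `f̃` is pure and typed: a point outside `Range f̃` avoids
  `Range f`, at half the stretch.  THE ROOF IS ITS TYPED CASE.
* STRUCTURE of typed instances (`mem_range_typed_iff`): the XOR part and the AND part can be chosen independently,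
  `Range = {cutVec t ⊕ cliqueVec z}` = Cut(G_L) ⊕ Clique(G_A) (`cutVec t j = t_{a_j} ⊕ t_{b_j}` is the cut vector of
  the vertex set `t` in the XOR graph, `cliqueVec z j = z_{c_j} ∧ z_{d_j}` the induced-edge vector of `z` in the AND graph);
  hence `y ∉ Range ↔ ∀ z, y ⊕ cliqueVec z ∉ Cut(G_L)` (`not_mem_range_typed_iff`).

CANONICAL NAMES (read this first).  The planner's file `Summits.PneNP.PneNP.Theorems.PstarTyped` landed the same
doubling and structure theorem minutes earlier (parallel work); its names are the CANONICAL ones: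
`PstarTyped.Typed`, `PstarTyped.TypedPstar` (= `TypedPure` here), `PstarTyped.typedDouble` (= `typedDouble` here,
definitionally — `PstarTypedDoubleFP.typedDouble_eq_canonical`), `PstarTyped.eval_typedDouble_append`,
`PstarTyped.range_subset_range_typedDouble`, `PstarTyped.not_mem_range_of_typedDouble`, `PstarTyped.cutVec` /
`PstarTyped.cliqueVec` (indexed by `Finset`s; here by Boolean vectors), `PstarTyped.mem_range_typed_iff`.  Cite those;
the decls below are kept only because landed declarations are append-only.  New here and not in `PstarTyped`:
`PstarTypedAvoidLinearFP` (the typed rung as a named `Prop`), `typedAvoid_of_pstarAvoid`, `cutSet`,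
`not_mem_range_typed_iff`; the FP transfer is `PstarTypedDoubleFP.pstarAvoid_iff_typedPstarAvoid`.
-/

set_option linter.dupNamespace false

open Finset Literature.Computability.Complexity

namespace Summit.PneNP.PneNP.Theorems.PstarTypedDouble

variable {n m : ℕ}

/-! ## Typed instances -/

/-- Slot `s` is an XOR slot (`0,1`) of `P⋆ = x₀ ⊕ x₁ ⊕ x₂·x₃`; slots `2,3` are the AND slots. -/
abbrev IsXorSlot (s : Fin 4) : Prop := s.val < 2

/-- **Typed instance**: no variable is read both by an XOR slot and by an AND slot (of any two outputs).
(Canonical: `PstarTyped.Typed`, equivalent — `PstarTypedDoubleFP.typedPure_iff_typedPstar`.) -/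
def Typed (I : LocalMap 4 n m) : Prop :=
  ∀ (j j' : Fin m) (s t : Fin 4), IsXorSlot s → ¬IsXorSlot t → I.vars j s ≠ I.vars j' t

/-- The promise class "pure `P⋆` and typed".  (Canonical: `PstarTyped.TypedPstar`.) -/
def TypedPure : ∀ ⦃n m : ℕ⦄, LocalMap 4 n m → Prop := fun _ _ I => I.IsPure xorAndPred ∧ Typed I

/-- **Typed pure-`P⋆` range avoidance at linear stretch is in FP** (statement; the typed case of the roof). -/
def PstarTypedAvoidLinearFP : Prop := LocalAvoidLinearFP 4 TypedPure

/-- Typed instances are instances: the roof implies its typed case (same constant, same avoider). -/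
theorem typedAvoid_of_pstarAvoid : PstarIsolation.PstarAvoidLinearFP → PstarTypedAvoidLinearFP :=
  LocalAvoidLinearFP.anti fun _ _ _ h => h.1

/-! ## Doubling -/

/-- The doubled position of slot `s` reading variable `v`: XOR slots read the first copy, AND slots the second. -/
def dvar (n : ℕ) (s : Fin 4) (v : Fin n) : Fin (n + n) := if IsXorSlot s then Fin.castAdd n v else Fin.natAdd n v

/-- Its numerical value: `v` for XOR slots, `n + v` for AND slots. -/
theorem dvar_val (s : Fin 4) (v : Fin n) : (dvar n s v).val = if IsXorSlot s then v.val else n + v.val := by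
  unfold dvar
  split_ifs
  · simp
  · simp [Nat.add_comm]

/-- **The typed double** `f̃` of an instance: `f̃(t, z)_j = T_j(t_{a_j}, t_{b_j}, z_{c_j}, z_{d_j})` on `n + n` inputs
(same tables; XOR slots on the first copy of the variables, AND slots on the second copy).
(Canonical: `PstarTyped.typedDouble`, definitionally equal — `PstarTypedDoubleFP.typedDouble_eq_canonical`.) -/
def typedDouble (I : LocalMap 4 n m) : LocalMap 4 (n + n) m where
  vars := fun j s => dvar n s (I.vars j s)
  table := I.table

/-- The double evaluated on the diagonal `(x, x)` is the original map: `f̃(x,x) = f(x)`. -/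
theorem eval_typedDouble_append (I : LocalMap 4 n m) (x : Fin n → Bool) :
    (typedDouble I).eval (Fin.append x x) = I.eval x := by
  funext j
  simp only [LocalMap.eval, typedDouble]
  congr 1
  funext s
  unfold dvar
  split_ifs
  · exact Fin.append_left x x _
  · exact Fin.append_right x x _

/-- **T20.1** `Range f ⊆ Range f̃`: every value of the map is a value of its typed double.
(Canonical: `PstarTyped.range_subset_range_typedDouble`.) -/
theorem range_subset_range_typedDouble (I : LocalMap 4 n m) : I.range ⊆ (typedDouble I).range := by
  rintro y ⟨x, rfl⟩
  exact ⟨Fin.append x x, eval_typedDouble_append I x⟩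

/-- Contrapositive: a point outside the range of the double avoids the range of the map. -/
theorem not_mem_range_of_typedDouble (I : LocalMap 4 n m) (y : Fin m → Bool)
    (hy : y ∉ (typedDouble I).range) : y ∉ I.range := fun h => hy (range_subset_range_typedDouble I h)

/-- The double is typed. -/
theorem typed_typedDouble (I : LocalMap 4 n m) : Typed (typedDouble I) := by
  intro j j' s t hs ht h
  have hv := congrArg Fin.val h
  simp only [typedDouble, dvar_val, if_pos hs, if_neg ht] at hv
  have := (I.vars j s).isLt
  omega

/-- The double of a pure instance is pure (same table; the four doubled positions stay distinct). -/
theorem isPure_typedDouble {P : (Fin 4 → Bool) → Bool} (I : LocalMap 4 n m) (hI : I.IsPure P) :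
    (typedDouble I).IsPure P := by
  refine ⟨fun j => hI.1 j, fun j s t h => ?_⟩
  have hv := congrArg Fin.val h
  simp only [typedDouble, dvar_val] at hv
  by_cases hs : IsXorSlot s <;> by_cases ht : IsXorSlot t
  · rw [if_pos hs, if_pos ht] at hv
    exact hI.2 j (Fin.ext hv)
  · rw [if_pos hs, if_neg ht] at hv
    have := (I.vars j s).isLt
    omega
  · rw [if_neg hs, if_pos ht] at hv
    have := (I.vars j t).isLt
    omega
  · rw [if_neg hs, if_neg ht] at hv
    exact hI.2 j (Fin.ext (by omega))

/-- The double of a pure `P⋆` instance is in the typed promise class. -/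
theorem typedPure_typedDouble (I : LocalMap 4 n m) (hI : I.IsPure xorAndPred) : TypedPure (typedDouble I) :=
  ⟨isPure_typedDouble I hI, typed_typedDouble I⟩

/-! ## Typed instances: `Range = Cut(G_L) ⊕ Clique(G_A)` -/

/-- The cut vector of the vertex set `t` in the XOR graph: `(cutVec t)_j = t_{a_j} ⊕ t_{b_j}`. -/
def cutVec (I : LocalMap 4 n m) (t : Fin n → Bool) : Fin m → Bool := fun j => xor (t (I.vars j 0)) (t (I.vars j 1))

/-- The induced-edge ("clique") vector of the vertex set `z` in the AND graph: `(cliqueVec z)_j = z_{c_j} ∧ z_{d_j}`. -/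
def cliqueVec (I : LocalMap 4 n m) (z : Fin n → Bool) : Fin m → Bool := fun j => z (I.vars j 2) && z (I.vars j 3)

/-- A pure `P⋆` map evaluates to `cutVec x ⊕ cliqueVec x`. -/
theorem eval_eq_cut_xor_clique (I : LocalMap 4 n m) (hI : I.IsPure xorAndPred) (x : Fin n → Bool) :
    I.eval x = fun j => xor (cutVec I x j) (cliqueVec I x j) := by
  funext j
  simp only [LocalMap.eval, hI.1 j, xorAndPred_apply, cutVec, cliqueVec]

/-- In a typed instance an AND-slot variable is not an XOR-slot variable. -/
theorem not_isXorVar_of_typed (I : LocalMap 4 n m) (hT : Typed I) (j : Fin m) (t : Fin 4) (ht : ¬IsXorSlot t) :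
    ¬∃ j' : Fin m, ∃ s : Fin 4, IsXorSlot s ∧ I.vars j' s = I.vars j t := by
  rintro ⟨j', s, hs, h⟩
  exact hT j' j s t hs ht h

/-- **T20.2 — `Range = Cut ⊕ Clique` for typed pure `P⋆` instances**: `y` is in the range iff
`y = cutVec t ⊕ cliqueVec z` for SOME vertex sets `t` (of the XOR graph) and `z` (of the AND graph), chosen
independently.  (Canonical: `PstarTyped.mem_range_typed_iff`, with `Finset`-indexed `cutVec`/`cliqueVec`.) -/
theorem mem_range_typed_iff (I : LocalMap 4 n m) (hI : I.IsPure xorAndPred) (hT : Typed I) (y : Fin m → Bool) :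
    y ∈ I.range ↔ ∃ t z : Fin n → Bool, y = fun j => xor (cutVec I t j) (cliqueVec I z j) := by
  constructor
  · rintro ⟨x, rfl⟩
    exact ⟨x, x, eval_eq_cut_xor_clique I hI x⟩
  · rintro ⟨t, z, rfl⟩
    classical
    -- glue: `t` on the XOR variables, `z` elsewhere
    let x : Fin n → Bool := fun v => if ∃ j' : Fin m, ∃ s : Fin 4, IsXorSlot s ∧ I.vars j' s = v then t v else z v
    refine ⟨x, ?_⟩
    rw [eval_eq_cut_xor_clique I hI x]
    funext j
    have h0 : x (I.vars j 0) = t (I.vars j 0) := if_pos ⟨j, 0, by decide, rfl⟩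
    have h1 : x (I.vars j 1) = t (I.vars j 1) := if_pos ⟨j, 1, by decide, rfl⟩
    have h2 : x (I.vars j 2) = z (I.vars j 2) := if_neg (not_isXorVar_of_typed I hT j 2 (by decide))
    have h3 : x (I.vars j 3) = z (I.vars j 3) := if_neg (not_isXorVar_of_typed I hT j 3 (by decide))
    simp only [cutVec, cliqueVec, h0, h1, h2, h3]

/-- The cut space of the XOR graph, as a set of vectors. -/
def cutSet (I : LocalMap 4 n m) : Set (Fin m → Bool) := Set.range (cutVec I)

/-- **AVOID for typed instances**: `y ∉ Range ↔` for every vertex set `z` of the AND graph, `y ⊕ cliqueVec z` is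
not a cut vector of the XOR graph. -/
theorem not_mem_range_typed_iff (I : LocalMap 4 n m) (hI : I.IsPure xorAndPred) (hT : Typed I)
    (y : Fin m → Bool) :
    y ∉ I.range ↔ ∀ z : Fin n → Bool, (fun j => xor (y j) (cliqueVec I z j)) ∉ cutSet I := by
  rw [mem_range_typed_iff I hI hT y]
  constructor
  · rintro h z ⟨t, ht⟩
    apply h
    refine ⟨t, z, funext fun j => ?_⟩
    have hj : cutVec I t j = xor (y j) (cliqueVec I z j) := congrFun ht j
    show y j = xor (cutVec I t j) (cliqueVec I z j)
    rw [hj]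
    cases y j <;> cases cliqueVec I z j <;> rfl
  · rintro h ⟨t, z, rfl⟩
    apply h z
    refine ⟨t, funext fun j => ?_⟩
    show cutVec I t j = xor (xor (cutVec I t j) (cliqueVec I z j)) (cliqueVec I z j)
    cases cutVec I t j <;> cases cliqueVec I z j <;> rfl

end Summit.PneNP.PneNP.Theorems.PstarTypedDouble
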